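import Summits.Ventures.LatticeQCDFlow.TrivializingMaps.MeanActionFloorSUN

/-!
HONEST FRAMING: exact (Metropolis-corrected) sampling algorithms for lattice gauge theory; figures
of merit are autocorrelation/cost numbers at stated couplings and volumes; no continuum-physics
claim.

# EntropyFromHaar — `D(μ_β ‖ Haar^{⊗E}) = ∫_0^β t·Var_t(S_W) dt`: THE RELATIVE ENTROPY OF THE WILSON
# MEASURE FROM THE HAAR PRIOR IS EXTENSIVE AT EVERY COUPLING FOR EVERY COMPACT GAUGE GROUP
# (`≥ e^{−c|β|}⌊L/2⌋^d v_ρ β²/2`), AND `≥ (c/2)·#plaq·log(1+β²)` FOR `SU(n)` (lean-2 GEN-10, ours)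

Venture-side (OURS).  Cell `lqcd-flow` (pub-lqcd), unit `pub-lqcd-lean-2-g10`, 2026-08-23.  The venture's
entropy-budget files (`Scaling/EntropyBudget*`, `LatticeEntropy*`) price every exact flow sampler from the
Haar prior by `D(μ_{Λ,β} ‖ Haar^{⊗E})` and prove its growth `κ(…)L^d log β ± C L^d` for `U(1)`, `U(N)`,
`SU(N)` under one-plaquette inputs, `β ≥ 1`.  Here, from the coupling dictionary of `CouplingKLAnyGroup`
(`D(μ_a‖μ_b)` = Bregman divergence of `ψ = log Z`) at `b = 0` (`μ_0 = D[U]`,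
`wilsonMeasure_zero_eq_trivialMeasure`):

* §1 (every compact `G`, continuous `ρ`, all real `β`): **`toReal_klDiv_haar_eq`**: `D(μ_β ‖ D[U]) =
  β·ψ′(β) − ψ(β)` (`= −β⟨S_W⟩_β − log Z(β)`, the tree's `gibbsIdentity` in `cgf` form);
  **`toReal_klDiv_haar_eq_integral`**: `D(μ_β ‖ D[U]) = ∫_0^β t·Var_t(S_W) dt` (its derivative in `β` is
  `β·Var_β`).
* §2 (unitary `ρ`, `d ≥ 2`, `L ≥ 2`, GEN-9's all-coupling floor): **`klDiv_haar_ge_anyGroup`**: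
  `D(μ_β ‖ D[U]) ≥ e^{−c|β|}·⌊L/2⌋^d·Var_Haar(Re tr ρ)·β²/2` for every `β ≥ 0` (`c = 2NK(1+4K)`,
  `K = (d+1)d²`) — EXTENSIVE IN THE VOLUME AT EVERY COUPLING `β > 0` whenever `Var_Haar(Re tr ρ) > 0`, for
  every compact gauge group, with no expansion and no one-plaquette input; and `≤ 2N·#plaq·β`
  (`klDiv_haar_le_volume`).
* §3 (`SU(n)`, `n ≥ 2`, `d ≥ 2`, theory2's item 129 floor `c·#plaq/(1+t²)`): **`wilson_klDiv_haar_ge_log`**: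
  one `c = c(n,d) > 0` with **`(c/2)·#plaq·log(1 + β²) ≤ D(μ_β ‖ D[U])`** for every `β ≥ 0` and every
  `L ≥ 2` — the `log β` entropy growth as a clean all-`β`, all-`L` floor (the tree's `SUN.entropyGrowthLaw`
  has the sharp coefficient `(n²−1)(d−1)L^d/2` but an `O(L^d)` offset and `β ≥ 1`).

NOT CLAIMED: the sharp coefficient; any upper bound better than `2N·#plaq·β` (the tree's entropy-growth
upper half is `O(L^d log β)`); anything about flows' capacity beyond what `Scaling/EntropyBudget*` already
derive from `D`.  Literature grade (cell rule): elementary; new typing.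
-/

noncomputable section

open MeasureTheory ProbabilityTheory Set intervalIntegral InformationTheory
open Literature.MathematicalPhysics.QuantumFieldTheory
open Literature.MathematicalPhysics.QuantumFieldTheory.Luscher2010
open scoped Matrix Matrix.Norms.Frobenius ContDiff

namespace Summit.Ventures.LatticeQCDFlow.TrivializingMaps

section AnyGroup

variable {d L N : ℕ} [NeZero L] {G : Type*} [Group G] [TopologicalSpace G] [IsTopologicalGroup G]
  [CompactSpace G] [MeasurableSpace G] [BorelSpace G] [SecondCountableTopology G]
  (ρ : G →* Matrix (Fin N) (Fin N) ℂ)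

/-! ## §1 `D(μ_β ‖ D[U]) = β·ψ′(β) − ψ(β) = ∫_0^β t·Var_t dt` -/

omit [SecondCountableTopology G] in
/-- `ψ(0) = 0`. [folklore] -/
theorem cgf_neg_wilsonAction_zero :
    cgf (fun U => -wilsonAction ρ U) (trivialMeasure G d L) 0 = 0 := by
  haveI : IsProbabilityMeasure (trivialMeasure G d L) := by unfold trivialMeasure; infer_instance
  exact cgf_zero

/-- **`D(μ_β ‖ D[U]) = β·ψ′(β) − ψ(β)`** (`ψ = cgf(−S_W^ρ)`; equivalently `−β⟨S_W⟩_β − log Z(β)`), every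
compact gauge group, every real `β`. [folklore] -/
theorem toReal_klDiv_haar_eq (hρ : Continuous ρ) (β : ℝ) :
    (klDiv (wilsonMeasure (d := d) (L := L) ρ β) (trivialMeasure G d L)).toReal =
      β * deriv (cgf (fun U => -wilsonAction ρ U) (trivialMeasure G d L)) β -
        cgf (fun U => -wilsonAction ρ U) (trivialMeasure G d L) β := by
  have h := toReal_klDiv_wilsonMeasure_eq_bregman (d := d) (L := L) ρ hρ β 0
  rw [wilsonMeasure_zero_eq_trivialMeasure (d := d) (L := L) ρ, cgf_neg_wilsonAction_zero] at h
  rw [h]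
  ring

/-- `F(β) = β·ψ′(β) − ψ(β)` has derivative `β·Var_β(S_W)`. [folklore] -/
theorem hasDerivAt_klDiv_haar (hρ : Continuous ρ) (β : ℝ) :
    HasDerivAt (fun t => t * deriv (cgf (fun U => -wilsonAction ρ U) (trivialMeasure G d L)) t -
        cgf (fun U => -wilsonAction ρ U) (trivialMeasure G d L) t)
      (β * variance (wilsonAction (d := d) (L := L) ρ) (wilsonMeasure (d := d) (L := L) ρ β)) β := by
  have h1 := hasDerivAt_deriv_cgf_anyGroup (d := d) (L := L) hρ β
  have h2 := hasDerivAt_cgf_anyGroup (d := d) (L := L) hρ β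
  have h3 := ((hasDerivAt_id β).mul h1).sub h2
  refine h3.congr_deriv ?_
  simp only [id]
  ring

/-- **`D(μ_β ‖ D[U]) = ∫_0^β t·Var_t(S_W^ρ) dt`**, every compact gauge group, every real `β`. [ours] -/
theorem toReal_klDiv_haar_eq_integral (hρ : Continuous ρ) (β : ℝ) :
    (klDiv (wilsonMeasure (d := d) (L := L) ρ β) (trivialMeasure G d L)).toReal =
      ∫ t in (0 : ℝ)..β, t * variance (wilsonAction (d := d) (L := L) ρ)
        (wilsonMeasure (d := d) (L := L) ρ t) := by
  have hcont : Continuous fun t : ℝ => t * variance (wilsonAction (d := d) (L := L) ρ)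
      (wilsonMeasure (d := d) (L := L) ρ t) :=
    continuous_id.mul (continuous_variance_wilsonMeasure hρ)
  rw [integral_eq_sub_of_hasDerivAt (fun t _ => hasDerivAt_klDiv_haar (d := d) (L := L) ρ hρ t)
    (hcont.intervalIntegrable _ _), toReal_klDiv_haar_eq ρ hρ β, cgf_neg_wilsonAction_zero]
  simp

/-! ## §2 Extensive at every coupling, every compact gauge group -/

/-- **`D(μ_β ‖ D[U]) ≥ m·β²/2` from a variance floor `m ≥ 0` on `[0, β]`** (`β ≥ 0`). [ours] -/
theorem klDiv_haar_ge_of_floor (hρ : Continuous ρ) {β m : ℝ} (hβ : 0 ≤ β)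
    (hm : ∀ t ∈ Icc 0 β, m ≤ variance (wilsonAction (d := d) (L := L) ρ)
      (wilsonMeasure (d := d) (L := L) ρ t)) :
    m * β ^ 2 / 2 ≤ (klDiv (wilsonMeasure (d := d) (L := L) ρ β) (trivialMeasure G d L)).toReal := by
  rw [toReal_klDiv_haar_eq_integral ρ hρ β]
  have hlin : ∫ t in (0 : ℝ)..β, t * m = m * β ^ 2 / 2 := by
    rw [intervalIntegral.integral_mul_const, integral_id]; ring
  rw [← hlin]
  refine intervalIntegral.integral_mono_on hβ ((continuous_id.mul continuous_const).intervalIntegrable _ _)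
    ((continuous_id.mul (continuous_variance_wilsonMeasure hρ)).intervalIntegrable _ _) fun t ht => ?_
  exact mul_le_mul_of_nonneg_left (hm t ht) ht.1

/-- **EXTENSIVE RELATIVE ENTROPY AT EVERY COUPLING, EVERY COMPACT GAUGE GROUP**: for unitary continuous
`ρ`, `d ≥ 2`, `L ≥ 2` and every `β ≥ 0`,
`e^{−βc}·⌊L/2⌋^d·Var_Haar(Re tr ρ)·β²/2 ≤ D(μ_β ‖ D[U])`, `c = 2NK(1+4K)`, `K = (d+1)d²`
(GEN-9's all-coupling floor integrated). [ours] -/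
theorem klDiv_haar_ge_anyGroup (hd : 2 ≤ d) (hL : 2 ≤ L) (hρ : Continuous ρ)
    (hρu : ∀ g, ρ g ∈ Matrix.unitaryGroup (Fin N) ℂ) {β : ℝ} (hβ : 0 ≤ β) :
    Real.exp (-(β * (2 * N * ((d + 1) * d ^ 2 : ℕ) * (1 + 4 * ((d + 1) * d ^ 2 : ℕ))))) *
          ((L / 2) ^ d : ℕ) * variance (fun g => (ρ g).trace.re) (haarProbability G) * β ^ 2 / 2 ≤
      (klDiv (wilsonMeasure (d := d) (L := L) ρ β) (trivialMeasure G d L)).toReal := by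
  set c : ℝ := 2 * N * ((d + 1) * d ^ 2 : ℕ) * (1 + 4 * ((d + 1) * d ^ 2 : ℕ)) with hc
  refine klDiv_haar_ge_of_floor (d := d) (L := L) ρ hρ hβ fun t ht => ?_
  have hfloor := wilson_variance_ge_allCouplings (d := d) (L := L) ρ hd hL hρ hρu t
  rw [← hc] at hfloor
  refine le_trans ?_ hfloor
  have hc0 : 0 ≤ c := by rw [hc]; positivity
  have hv : 0 ≤ variance (fun g => (ρ g).trace.re) (haarProbability G) := variance_nonneg _ _
  have ht' : |t| ≤ β := by rw [abs_of_nonneg ht.1]; exact ht.2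
  have hexp : Real.exp (-(β * c)) ≤ Real.exp (-(|t| * c)) := Real.exp_le_exp.2 (by nlinarith)
  have hLd : (0 : ℝ) ≤ ((L / 2) ^ d : ℕ) := by positivity
  exact mul_le_mul_of_nonneg_right (mul_le_mul_of_nonneg_right hexp hLd) hv

/-- **`D(μ_β ‖ D[U]) ≤ 2N·#plaq·β`** for `β ≥ 0`, every compact gauge group. [ours] -/
theorem klDiv_haar_le_volume (hρ : Continuous ρ) {β : ℝ} (hβ : 0 ≤ β) :
    (klDiv (wilsonMeasure (d := d) (L := L) ρ β) (trivialMeasure G d L)).toReal ≤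
      2 * N * Fintype.card (Plaquette d L) * β := by
  rw [← wilsonMeasure_zero_eq_trivialMeasure (d := d) (L := L) ρ]
  have h := (klDiv_wilsonMeasure_le_volume (d := d) (L := L) ρ hρ hβ).2
  simpa using h

end AnyGroup

/-! ## §3 `SU(n)`: `D(μ_β ‖ D[U]) ≥ (c/2)·#plaq·log(1 + β²)` -/

section SUN

variable {d n : ℕ}

/-- `∫_0^β t/(1+t²) dt = log(1+β²)/2`. [folklore] -/
theorem integral_div_one_add_sq (β : ℝ) :
    ∫ t in (0 : ℝ)..β, t / (1 + t ^ 2) = Real.log (1 + β ^ 2) / 2 := by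
  have hderiv : ∀ t : ℝ, HasDerivAt (fun s : ℝ => Real.log (1 + s ^ 2) / 2) (t / (1 + t ^ 2)) t := by
    intro t
    have h1 : HasDerivAt (fun s : ℝ => 1 + s ^ 2) (2 * t) t := by
      have := ((hasDerivAt_pow 2 t).const_add 1)
      simpa using this
    have h2 := (Real.hasDerivAt_log (by positivity : (1 + t ^ 2) ≠ 0)).comp t h1
    have h3 := h2.div_const 2
    refine h3.congr_deriv ?_
    field_simp
  have hcont : Continuous fun t : ℝ => t / (1 + t ^ 2) :=
    continuous_id.div (by fun_prop) fun t => by positivity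
  rw [integral_eq_sub_of_hasDerivAt (fun t _ => hderiv t) (hcont.intervalIntegrable _ _)]
  simp

/-- **`(c/2)·#plaq·log(1 + β²) ≤ D(μ_β ‖ D[U])` for every `β ≥ 0`, every `L ≥ 2`** (`SU(n)`, `n ≥ 2`,
`d ≥ 2`; `c = c(n,d)` the constant of item 129's all-coupling floor). [ours] -/
theorem wilson_klDiv_haar_ge_log (hn : 2 ≤ n) (hd : 2 ≤ d) :
    ∃ c : ℝ, 0 < c ∧ ∀ (L : ℕ) [NeZero L], 2 ≤ L → ∀ β : ℝ, 0 ≤ β →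
      c / 2 * Fintype.card (Plaquette d L) * Real.log (1 + β ^ 2) ≤
        (klDiv (wilsonMeasure (d := d) (L := L) (StrongCoupling.defRep n) β)
          (trivialMeasure (Matrix.specialUnitaryGroup (Fin n) ℂ) d L)).toReal := by
  obtain ⟨c, hc, h⟩ := wilson_variance_floor_allCouplings_rep (d := d) (n := n) hn hd
  refine ⟨c, hc, fun L _ hL β hβ => ?_⟩
  have hρ : Continuous (StrongCoupling.defRep n) := continuous_subtype_val
  set P : ℝ := (Fintype.card (Plaquette d L) : ℝ) with hP
  rw [toReal_klDiv_haar_eq_integral (StrongCoupling.defRep n) hρ β]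
  have hval : ∫ t in (0 : ℝ)..β, c * P * (t / (1 + t ^ 2)) = c / 2 * P * Real.log (1 + β ^ 2) := by
    rw [intervalIntegral.integral_const_mul, integral_div_one_add_sq]; ring
  rw [← hval]
  have hcont : Continuous fun t : ℝ => c * P * (t / (1 + t ^ 2)) :=
    continuous_const.mul (continuous_id.div (by fun_prop) fun t => by positivity)
  refine intervalIntegral.integral_mono_on hβ (hcont.intervalIntegrable _ _)
    ((continuous_id.mul (continuous_variance_wilsonMeasure hρ)).intervalIntegrable _ _) fun t ht => ?_
  have h1 := h L hL t ht.1
  have ht2 : (0 : ℝ) < 1 + t ^ 2 := by positivity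
  calc c * P * (t / (1 + t ^ 2)) = t * (c * P / (1 + t ^ 2)) := by ring
    _ ≤ t * variance (wilsonAction (d := d) (L := L) (StrongCoupling.defRep n))
          (wilsonMeasure (d := d) (L := L) (StrongCoupling.defRep n) t) :=
        mul_le_mul_of_nonneg_left h1 ht.1

end SUN

end Summit.Ventures.LatticeQCDFlow.TrivializingMaps

end
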